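import Summits.CriticalPhenomena.Ising3DConformalLimit.Theorems.LinkingParityCirclesSpinRatioMoebiusEquivalences

/-!
# Line `registered` of crux `LinkingParityCircles.SpinRatioMoebius` (stmt-CriticalPhenomena-4530) is TIGHT

The registered skeleton of the crux (`Cruxes/SpinRatioMoebius/Lines/registered.lean`) is closed modulo exactly two OPEN
stubs: `stub_ratioLimitExists` (existence of the locally uniform limits of the weight-free spin pairing ratios
`Q^δ_m = ⟨∏σ_{[xᵢ/δ]}⟩ / ∏_j ⟨σ_{[x_j/δ]}σ_{[x_{j+m}/δ]}⟩` of the critical Ising model on `ℤ³`) and `stub_ratioInversion`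
(asymptotic invariance of `Q^δ_m` under the unit inversion `x ↦ x/‖x‖²` on the lattice).  This file kernel-checks that
the cut has NO SLACK: the crux is EQUIVALENT to the conjunction of the two stubs
(`SpinRatioMoebius_iff_ratioLimits_and_ratioInversion`), i.e. each open stub is necessary; and, given the first stub,
the second is EQUIVALENT to item stmt-CriticalPhenomena-4840 `CurrentConnectionInvariance.RatioInversionInvariance`
(`ratioInversion_iff_CCIRatioInversion_of_ratioLimits`).  Together with the landed
`SpinRatioMoebius_iff_moebiusLimit` (crux ⇔ item 1344) and `ratioLimits_iff_CCIRatioLimit` (first stub ⇔ item 4841 ⇔ 4738)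
this places every piece of the line on an existing open item of a sibling route: the line is exactly as hard as the
crux, which is exactly item 1344 (existence + Möbius covariance of the critical scaling limit on `ℤ³`,
H. Duminil-Copin, Proc. ICM 2022, §8.4: open).

References: H. Duminil-Copin, *100 years of the (critical) Ising model on the hypercubic lattice*, Proc. ICM 2022,
§8.1 and §8.4; P. Di Francesco, P. Mathieu, D. Sénéchal, *Conformal Field Theory* (Springer 1997) §4.3.1.
-/

noncomputable section

namespace Summit.CriticalPhenomena.Ising3DConformalLimit.Cruxes.SpinRatioMoebius.Birth

open Literature.Probability.LatticeModels Filter Set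
open Summit.CriticalPhenomena.Ising3DConformalLimit.Theses
open scoped Topology

/-- **The crux ⇒ asymptotic unit-inversion invariance of the pairing ratios on the lattice** (the open stub
`stub_ratioInversion` of line `registered` is NECESSARY): both `Q^δ_m(ι∘x)` and `Q^δ_m(x)` converge to the common value
`q_{2m}(ι∘x) = q_{2m}(x)` of the Möbius invariant limit. [folklore] -/
theorem ratioInversion_of_SpinRatioMoebius (h : LinkingParityCircles.SpinRatioMoebius) :
    ∀ (m : ℕ), ∀ x ∈ NonCoincident 3 (m + m), (∀ i, x i ≠ 0) → Tendsto (fun δ : ℝ =>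
      criticalCorr 3 (m + m) (fun i => latticeApprox δ (EuclideanGeometry.inversion 0 1 (x i))) /
          (∏ j : Fin m, criticalCorr 3 2 ![latticeApprox δ (EuclideanGeometry.inversion 0 1 (x (Fin.castAdd m j))),
            latticeApprox δ (EuclideanGeometry.inversion 0 1 (x (Fin.natAdd m j)))]) -
        criticalCorr 3 (m + m) (fun i => latticeApprox δ (x i)) /
          (∏ j : Fin m, criticalCorr 3 2 ![latticeApprox δ (x (Fin.castAdd m j)), latticeApprox δ (x (Fin.natAdd m j))]))
      (𝓝[>] (0 : ℝ)) (𝓝 0) := by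
  obtain ⟨q, hMq, hq⟩ := h
  intro m x hx hx0
  have hιx : (fun i => EuclideanGeometry.inversion 0 1 (x i)) ∈ NonCoincident 3 (m + m) :=
    (comp_mem_nonCoincident_iff_of_injective (EuclideanGeometry.inversion_injective _ one_ne_zero) x).2 hx
  have hinv : q (m + m) (fun i => EuclideanGeometry.inversion 0 1 (x i)) = q (m + m) x := by
    have h := hMq.2.2 (m + m) x hx0
    have hw : (∏ i : Fin (m + m), ‖x i‖ ^ (2 * (0 : ℝ))) = 1 := by simp
    rwa [hw, one_mul] at h
  have h1 := (hq m).tendsto_at hιx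
  have h2 := (hq m).tendsto_at hx
  rw [hinv] at h1
  simpa using h1.sub h2

/-- **LINE TIGHTNESS: `SpinRatioMoebius ⇔ stub_ratioLimitExists ∧ stub_ratioInversion`.** The two OPEN stubs of the
registered skeleton of this crux (existence of the pairing-ratio limits; asymptotic unit-inversion invariance on the
lattice) are not only jointly sufficient (`SpinRatioMoebius_of_ratioLimits_of_ratioInversion`) but each NECESSARY, so no
reshape inside this composition can make either stub easier than the crux itself (= item stmt-CriticalPhenomena-1344,
`SpinRatioMoebius_iff_moebiusLimit`). [folklore] -/
theorem SpinRatioMoebius_iff_ratioLimits_and_ratioInversion :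
    Summit.CriticalPhenomena.Ising3DConformalLimit.Theses.LinkingParityCircles.SpinRatioMoebius ↔ (∃ q : Literature.Probability.LatticeModels.CorrFamily 3, ∀ m : ℕ, TendstoLocallyUniformlyOn (fun (δ : ℝ) (x : Fin (m + m) → EuclideanSpace ℝ (Fin 3)) => Literature.Probability.LatticeModels.criticalCorr 3 (m + m) (fun i => Literature.Probability.LatticeModels.latticeApprox δ (x i)) / ∏ j : Fin m, Literature.Probability.LatticeModels.criticalCorr 3 2 ![Literature.Probability.LatticeModels.latticeApprox δ (x (Fin.castAdd m j)), Literature.Probability.LatticeModels.latticeApprox δ (x (Fin.natAdd m j))]) (q (m + m)) (nhdsWithin 0 (Set.Ioi 0)) (Literature.Probability.LatticeModels.NonCoincident 3 (m + m))) ∧ (∀ (m : ℕ), ∀ x ∈ Literature.Probability.LatticeModels.NonCoincident 3 (m + m), (∀ i, x i ≠ 0) → Filter.Tendsto (fun δ : ℝ => Literature.Probability.LatticeModels.criticalCorr 3 (m + m) (fun i => Literature.Probability.LatticeModels.latticeApprox δ (EuclideanGeometry.inversion 0 1 (x i))) / (∏ j : Fin m, Literature.Probability.LatticeModels.criticalCorr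 3 2 ![Literature.Probability.LatticeModels.latticeApprox δ (EuclideanGeometry.inversion 0 1 (x (Fin.castAdd m j))), Literature.Probability.LatticeModels.latticeApprox δ (EuclideanGeometry.inversion 0 1 (x (Fin.natAdd m j)))]) - Literature.Probability.LatticeModels.criticalCorr 3 (m + m) (fun i => Literature.Probability.LatticeModels.latticeApprox δ (x i)) / (∏ j : Fin m, Literature.Probability.LatticeModels.criticalCorr 3 2 ![Literature.Probability.LatticeModels.latticeApprox δ (x (Fin.castAdd m j)), Literature.Probability.LatticeModels.latticeApprox δ (x (Fin.natAdd m j))])) (nhdsWithin 0 (Set.Ioi 0)) (nhds 0)) :=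
  ⟨fun h => ⟨let ⟨q, _, hq⟩ := h; ⟨q, hq⟩, ratioInversion_of_SpinRatioMoebius h⟩,
    fun h => SpinRatioMoebius_of_ratioLimits_of_ratioInversion h.1 h.2⟩

/-- **The inversion stub in the DAG of items**: given the ratio limits, asymptotic lattice inversion invariance of the
pairing ratios is EQUIVALENT to item stmt-CriticalPhenomena-4840 `CurrentConnectionInvariance.RatioInversionInvariance`
(⇐ by `stub_ratioInversionOfCCI` with the GKS bound; ⇒ through the crux and item 1344). [folklore] -/
theorem ratioInversion_iff_CCIRatioInversion_of_ratioLimits :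
    (∃ q : Literature.Probability.LatticeModels.CorrFamily 3, ∀ m : ℕ, TendstoLocallyUniformlyOn (fun (δ : ℝ) (x : Fin (m + m) → EuclideanSpace ℝ (Fin 3)) => Literature.Probability.LatticeModels.criticalCorr 3 (m + m) (fun i => Literature.Probability.LatticeModels.latticeApprox δ (x i)) / ∏ j : Fin m, Literature.Probability.LatticeModels.criticalCorr 3 2 ![Literature.Probability.LatticeModels.latticeApprox δ (x (Fin.castAdd m j)), Literature.Probability.LatticeModels.latticeApprox δ (x (Fin.natAdd m j))]) (q (m + m)) (nhdsWithin 0 (Set.Ioi 0)) (Literature.Probability.LatticeModels.NonCoincident 3 (m + m))) → ((∀ (m : ℕ), ∀ x ∈ Literature.Probability.LatticeModels.NonCoincident 3 (m + m), (∀ i, x i ≠ 0) → Filter.Tendsto (fun δ : ℝ => Literature.Probability.LatticeModels.criticalCorr 3 (m + m) (fun i => Literature.Probability.LatticeModels.latticeApprox δ (EuclideanGeometry.inversion 0 1 (x i))) / (∏ j : Fin m, Literature.Probability.LatticeModels.criticalCorr 3 2 ![Literature.Probability.LatticeModels.latticeApprox δ (EuclideanGeometry.inversion 0 1 (x (Fin.castAdd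 m j))), Literature.Probability.LatticeModels.latticeApprox δ (EuclideanGeometry.inversion 0 1 (x (Fin.natAdd m j)))]) - Literature.Probability.LatticeModels.criticalCorr 3 (m + m) (fun i => Literature.Probability.LatticeModels.latticeApprox δ (x i)) / (∏ j : Fin m, Literature.Probability.LatticeModels.criticalCorr 3 2 ![Literature.Probability.LatticeModels.latticeApprox δ (x (Fin.castAdd m j)), Literature.Probability.LatticeModels.latticeApprox δ (x (Fin.natAdd m j))])) (nhdsWithin 0 (Set.Ioi 0)) (nhds 0)) ↔ Summit.CriticalPhenomena.Ising3DConformalLimit.Theses.CurrentConnectionInvariance.RatioInversionInvariance) :=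
  fun hL => ⟨fun hI => (CCI_items_of_moebiusLimit
      (moebiusLimit_of_SpinRatioMoebius (SpinRatioMoebius_of_ratioLimits_of_ratioInversion hL hI))).2.2,
    fun hRI => stub_ratioInversionOfCCI stub_prodPairsLe hL hRI⟩

end Summit.CriticalPhenomena.Ising3DConformalLimit.Cruxes.SpinRatioMoebius.Birth

end
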